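import Summits.Ventures.HodgeRepro2.T6N43Main

/-!
# T6N43Weights — the Eischen–Liu weight dictionary of N4.3's record IN KERNEL: the weights `(τ; ν)` of
the forced archimedean modules at the three real places, and the L-factor display evaluated on them

FILED by seat t6-p6 (gen 19, wave 1; staged gen 16 as continuation-readiness of the RS-N4.3
lane, step 3; owner file route/T6-N43-t6-p6.md §20). The display `Hyp.EischenLiu2024_Sec2_2 a b τ ν r L`
(T6N43Hyp.lean) is consumed by `N43_places` / the M2 carrier with the bundle's weight / twist parameters
`(τ_j; ν_j; r_j)` as DATA; which `(τ; ν)` the record's forced modules carry was «the M2 composition's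
and not recorded» (the display's docstring). This file records the `(τ; ν)` part FROM PRINT and leaves
the twist `r` open:

* Eischen–Liu §2.2 (2.2.1) (text layer route/lit-1-EischenLiu-arXiv2006.04302v2-textlayer.txt p0008
  ll. 2–7): «the Harish-Chandra parameter of 𝒟_{(τ;ν)} equals (τ;ν) + (ρ_c − ρ_nc) = (τ₁ + (a−b−1)/2,
  …, τ_a + (−a−b+1)/2; ν₁ + (a+b−1)/2, …, ν_b + (a−b+1)/2)», with (p0007 ll. 41–46) «The half sum of
  compacts roots (resp. non-compact roots) of U(a,b) is ρ_c = ((a−1)/2, …, (−a+1)/2; (b−1)/2, …,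
  (−b+1)/2) (resp. ρ_nc = (b/2, …, b/2; −a/2, …, −a/2))»; §2.1 (p0007 ll. 19–24): U(a,b) is the unitary
  group of the form diag(1_a, −1_b), so `U(a) × U(b)` = the unitary groups of the positive-definite and
  of the negative-definite parts; §3.4 (p0019 ll. 3–11): «The joint harmonic polynomials correspond to
  vectors inside the direct sum of lowest K-types of the irreducible components in the decomposition
  (3.4.10) … with H_{(a,b),k}(m,l) corresponding to the lowest K-type of 𝒟_{(m;l)} ⊠ λ_{k,r}(m,l)» and
  (p0019 ll. 27–28) «Since F_{k,r,(τ;ν)} is the highest weight vector of weight (τ,ν), (ν*,τ*) for the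
  action of U(a) × U(b) ⊂ U(a,b) and U(b) × U(a) ⊂ U(b,a)» — i.e. the WEIGHT `(τ; ν)` of `𝒟_{(τ;ν)}` is
  the highest weight of its lowest `U(a) × U(b)`-type, `U(a)` on the positive-definite part, and the
  `K`-types of the holomorphic series climb along the positive non-compact roots `e_i − f_j` (the
  direction of `ρ_nc` as printed): `(τ₁ + k; ν₁ − k)`, `k ≥ 0`, for `(a, b) = (1, 1)`.
* The record (TIER5 §N4.3 R3.7 l. 1313 / (N4.3.P2) l. 1333; MEMO-route-2 §10.4 (B)): at τ′₁ (signature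
  (2,0): `U(2)` compact) «π₀,τ′₁ = det_{U(2)}^{(m′₁−3)/2}», t_W-weight ((m′₁−3)/2, (m′₁−3)/2); at τ′_j,
  j = 2, 3 (signature (1,1), W₊ the positive-definite line) «π₀,τ′_j = the irreducible U(1,1)-module
  with K-types {((m′_j+3)/2 + k, (m′_j−3)/2 − k) : k ≥ 0} (SU(1,1)-weights 3, 5, 7, …: the holomorphic
  discrete series of lowest weight 3, central character z^{m′_j})», lowest K-type ((m′_j+3)/2 ;
  (m′_j−3)/2); the weights m′_j are ODD (MEMO §10.3).

Hence, writing `n_j := (m′_j − 3)/2 ∈ ℤ` (so `m′_j = 2 n_j + 3`): τ′₁: `(τ; ν) = ((n₁, n₁); ())`;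
τ′_j: `(τ; ν) = ((n_j + 3); (n_j))`. These are `tauRec₁` / `nuRec₁` / `tauRec` / `nuRec` below — 6 of
the 9 dictionary numbers. The TWIST `r_j` (`χ_{V,τ′_j}|_{ℂ^×} = χ_ac^{r}`: the archimedean component
of the record's splitting character AS PRINTED, and the holomorphic-vs-contragredient sign discussed
in the display's docstring) is NOT fixed here: the display is EVALUATED on the record's weights for a
general `r` (`eischenLiu_tau1_iff`, `eischenLiu_tauj_iff`) and under BOTH candidate readings
`r = ±m′_j` (`…_twistPlus`, `…_twistMinus`) — none of them asserted. No display is declared here;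
nothing of Tiers 3–5 is re-opened. Axioms: {propext, Classical.choice, Quot.sound}.

§8(d): uses an L-value-free non-vanishing device: NO.
-/

namespace Summit.Ventures.HodgeRepro2.T6

namespace N43Weights

/-- `m′ = 2n + 3`: the record's ODD splitting-character weight at a real place (MEMO §10.3 «weights
m′_j ODD»), parametrised by the integer `n = (m′ − 3)/2` of (N4.3.P2). -/
def mPrime (n : ℤ) : ℤ := 2 * n + 3

/-- `m′ = 2n + 3` is odd. -/
theorem odd_mPrime (n : ℤ) : Odd (mPrime n) := ⟨n + 1, by unfold mPrime; ring⟩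

/-- `n = (m′ − 3)/2` recovered from `m′` (integer division is exact). -/
theorem mPrime_sub_three_div_two (n : ℤ) : (mPrime n - 3) / 2 = n := by
  unfold mPrime
  omega

/-- τ′₁ (signature (2,0), `U(2)` compact): the Eischen–Liu weight `τ` of `π₀,τ′₁ = det^{n}`,
`n = (m′₁ − 3)/2` — the highest weight `(n, n)` of the one-dimensional `U(2)`-type (R3.7: t_W-weight
((m′₁−3)/2, (m′₁−3)/2)). -/
def tauRec₁ (n : ℤ) : Fin 2 → ℤ := fun _ => n

/-- τ′₁ (signature (2,0)): the Eischen–Liu weight `ν` is empty. -/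
def nuRec₁ : Fin 0 → ℤ := fun i => i.elim0

/-- τ′_j, j = 2, 3 (signature (1,1)): the Eischen–Liu weight `τ` of `π₀,τ′_j` — the `U(1)_{W₊}`-weight
`(m′_j + 3)/2 = n_j + 3` of its lowest K-type ((m′_j+3)/2 ; (m′_j−3)/2) (R3.7 / (N4.3.P2)). -/
def tauRec (n : ℤ) : Fin 1 → ℤ := fun _ => n + 3

/-- τ′_j, j = 2, 3 (signature (1,1)): the Eischen–Liu weight `ν` of `π₀,τ′_j` — the `U(1)_{W₋}`-weight
`(m′_j − 3)/2 = n_j` of its lowest K-type. -/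
def nuRec (n : ℤ) : Fin 1 → ℤ := fun _ => n

/-- The `SU(1,1)`-weight of the lowest K-type at τ′_j is `3 = dim V` (R3.7: «the holomorphic discrete
series of lowest weight 3»). -/
theorem tauRec_sub_nuRec (n : ℤ) : tauRec n 0 - nuRec n 0 = 3 := by
  simp [tauRec, nuRec]

/-- The central weight of the lowest K-type at τ′_j is `m′_j` (R3.7: «central character z^{m′_j}»). -/
theorem tauRec_add_nuRec (n : ℤ) : tauRec n 0 + nuRec n 0 = mPrime n := by
  simp [tauRec, nuRec, mPrime]
  ring

/-- The Harish-Chandra parameter of `𝒟_{(τ;ν)}` for `(a, b) = (1, 1)` per Eischen–Liu (2.2.1),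
`(τ₁ − 1/2; ν₁ + 1/2)`, on the record's weights: `(n + 5/2; n + 1/2)` — its `SU(1,1)`-component
`τ₁ − ν₁ − 1 = 2` is the Harish-Chandra parameter of the holomorphic discrete series of lowest weight
`3` (record-consistency check; a computation, no print consumed). -/
theorem hcParam_su11 (n : ℤ) :
    ((tauRec n 0 : ℝ) - 1 / 2) - ((nuRec n 0 : ℝ) + 1 / 2) = 2 := by
  simp [tauRec, nuRec]
  ring

/-- THE DISPLAY AT τ′₁ ON THE RECORD'S WEIGHTS, EVALUATED: for signature `(2, 0)` and `τ = (n, n)` the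
printed product is `Γ_ℂ(s + |n − r/2 + 1/2|) · Γ_ℂ(s + |n − r/2 − 1/2|)` (the two exponents
`τ_j − r/2 + (a−b+1)/2 − j`, `j = 1, 2`; the `ν`-product over `Fin 0` is `1`). -/
theorem eischenLiu_tau1_iff (n r : ℤ) (L : ℂ → ℂ) :
    Hyp.EischenLiu2024_Sec2_2 2 0 (tauRec₁ n) nuRec₁ r L ↔
      ∀ s : ℂ, L s =
        T5GammaFactor.GammaC (s + ((|(n : ℝ) - (r : ℝ) / 2 + 1 / 2| : ℝ) : ℂ)) *
          T5GammaFactor.GammaC (s + ((|(n : ℝ) - (r : ℝ) / 2 - 1 / 2| : ℝ) : ℂ)) := by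
  unfold Hyp.EischenLiu2024_Sec2_2
  refine forall_congr' fun s => ?_
  simp only [Fin.prod_univ_two, Finset.univ_eq_empty, Finset.prod_empty, mul_one, tauRec₁,
    Fin.val_zero, Fin.val_one, Nat.cast_zero, Nat.cast_one, Nat.cast_ofNat]
  constructor
  · intro h
    rw [h]
    ring_nf
  · intro h
    rw [h]
    ring_nf

/-- THE DISPLAY AT τ′_j ON THE RECORD'S WEIGHTS, EVALUATED: for signature `(1, 1)` and
`(τ; ν) = ((n + 3); (n))` the printed product is `Γ_ℂ(s + |n − r/2 + 5/2|) · Γ_ℂ(s + |n − r/2 + 1/2|)`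
(exponents `τ₁ − r/2 + 1/2 − 1` and `ν₁ − r/2 + 3/2 − 1`). -/
theorem eischenLiu_tauj_iff (n r : ℤ) (L : ℂ → ℂ) :
    Hyp.EischenLiu2024_Sec2_2 1 1 (tauRec n) (nuRec n) r L ↔
      ∀ s : ℂ, L s =
        T5GammaFactor.GammaC (s + ((|(n : ℝ) - (r : ℝ) / 2 + 5 / 2| : ℝ) : ℂ)) *
          T5GammaFactor.GammaC (s + ((|(n : ℝ) - (r : ℝ) / 2 + 1 / 2| : ℝ) : ℂ)) := by
  unfold Hyp.EischenLiu2024_Sec2_2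
  refine forall_congr' fun s => ?_
  simp only [Fin.prod_univ_one, tauRec, nuRec, Fin.val_zero, Nat.cast_zero, Nat.cast_one,
    Int.cast_add, Int.cast_ofNat]
  constructor
  · intro h
    rw [h]
    ring_nf
  · intro h
    rw [h]
    ring_nf

section TwistReadings

/-! ### The two candidate twist readings `r = ±m′_j` — EVALUATED, none asserted

`χ_{V,τ′_j}|_{ℂ^×} = χ_ac^{r}` with `χ_ac(x) = x/(x x̄)^{1/2}` (Eischen–Liu §2.2) and the record's
splitting character of weight `m′_j` (MEMO §10.3) give `r = m′_j` or `r = −m′_j` according to the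
printed normalisation of «weight» for the splitting character and the holomorphic-vs-contragredient
sign (the display's docstring: «amounts to r ↦ −r»). Under `r = +m′_j` the record's archimedean
L-factors are INDEPENDENT of `m′_j`: `Γ_ℂ(s+1)Γ_ℂ(s+2)` at τ′₁ and `Γ_ℂ(s+1)²` at τ′_j; under
`r = −m′_j` they are `Γ_ℂ(s+|2n+2|)Γ_ℂ(s+|2n+1|)` and `Γ_ℂ(s+|2n+4|)Γ_ℂ(s+|2n+2|)`. Which reading
applies is the open print item of the lane (owner file §19.5 / §20); THEOREM N4.3 consumes only the
shape (`Lfac_one_ne_zero`). -/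

/-- τ′₁, reading `r = +m′₁`: the exponents are `|−1| = 1` and `|−2| = 2`. -/
theorem eischenLiu_tau1_twistPlus (n : ℤ) (L : ℂ → ℂ) :
    Hyp.EischenLiu2024_Sec2_2 2 0 (tauRec₁ n) nuRec₁ (mPrime n) L ↔
      ∀ s : ℂ, L s = T5GammaFactor.GammaC (s + 1) * T5GammaFactor.GammaC (s + 2) := by
  rw [eischenLiu_tau1_iff]
  have e₁ : (|(n : ℝ) - ((mPrime n : ℤ) : ℝ) / 2 + 1 / 2| : ℝ) = 1 := by
    rw [show (n : ℝ) - ((mPrime n : ℤ) : ℝ) / 2 + 1 / 2 = -1 by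
      simp only [mPrime, Int.cast_add, Int.cast_mul, Int.cast_ofNat]; ring]
    simp
  have e₂ : (|(n : ℝ) - ((mPrime n : ℤ) : ℝ) / 2 - 1 / 2| : ℝ) = 2 := by
    rw [show (n : ℝ) - ((mPrime n : ℤ) : ℝ) / 2 - 1 / 2 = -2 by
      simp only [mPrime, Int.cast_add, Int.cast_mul, Int.cast_ofNat]; ring]
    simp
  simp only [e₁, e₂, Complex.ofReal_one, Complex.ofReal_ofNat]

/-- τ′_j, reading `r = +m′_j`: the exponents are `|1| = 1` and `|−1| = 1`. -/
theorem eischenLiu_tauj_twistPlus (n : ℤ) (L : ℂ → ℂ) :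
    Hyp.EischenLiu2024_Sec2_2 1 1 (tauRec n) (nuRec n) (mPrime n) L ↔
      ∀ s : ℂ, L s = T5GammaFactor.GammaC (s + 1) * T5GammaFactor.GammaC (s + 1) := by
  rw [eischenLiu_tauj_iff]
  have e₁ : (|(n : ℝ) - ((mPrime n : ℤ) : ℝ) / 2 + 5 / 2| : ℝ) = 1 := by
    rw [show (n : ℝ) - ((mPrime n : ℤ) : ℝ) / 2 + 5 / 2 = 1 by
      simp only [mPrime, Int.cast_add, Int.cast_mul, Int.cast_ofNat]; ring]
    simp
  have e₂ : (|(n : ℝ) - ((mPrime n : ℤ) : ℝ) / 2 + 1 / 2| : ℝ) = 1 := by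
    rw [show (n : ℝ) - ((mPrime n : ℤ) : ℝ) / 2 + 1 / 2 = -1 by
      simp only [mPrime, Int.cast_add, Int.cast_mul, Int.cast_ofNat]; ring]
    simp
  simp only [e₁, e₂, Complex.ofReal_one]

/-- τ′₁, reading `r = −m′₁`: the exponents are `|2n + 2|` and `|2n + 1|`. -/
theorem eischenLiu_tau1_twistMinus (n : ℤ) (L : ℂ → ℂ) :
    Hyp.EischenLiu2024_Sec2_2 2 0 (tauRec₁ n) nuRec₁ (-mPrime n) L ↔
      ∀ s : ℂ, L s =
        T5GammaFactor.GammaC (s + ((|2 * (n : ℝ) + 2| : ℝ) : ℂ)) *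
          T5GammaFactor.GammaC (s + ((|2 * (n : ℝ) + 1| : ℝ) : ℂ)) := by
  rw [eischenLiu_tau1_iff]
  have e₁ : (|(n : ℝ) - ((-mPrime n : ℤ) : ℝ) / 2 + 1 / 2| : ℝ) = |2 * (n : ℝ) + 2| := by
    congr 1
    simp only [mPrime, Int.cast_neg, Int.cast_add, Int.cast_mul, Int.cast_ofNat]
    ring
  have e₂ : (|(n : ℝ) - ((-mPrime n : ℤ) : ℝ) / 2 - 1 / 2| : ℝ) = |2 * (n : ℝ) + 1| := by
    congr 1
    simp only [mPrime, Int.cast_neg, Int.cast_add, Int.cast_mul, Int.cast_ofNat]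
    ring
  simp only [e₁, e₂]

/-- τ′_j, reading `r = −m′_j`: the exponents are `|2n + 4|` and `|2n + 2|`. -/
theorem eischenLiu_tauj_twistMinus (n : ℤ) (L : ℂ → ℂ) :
    Hyp.EischenLiu2024_Sec2_2 1 1 (tauRec n) (nuRec n) (-mPrime n) L ↔
      ∀ s : ℂ, L s =
        T5GammaFactor.GammaC (s + ((|2 * (n : ℝ) + 4| : ℝ) : ℂ)) *
          T5GammaFactor.GammaC (s + ((|2 * (n : ℝ) + 2| : ℝ) : ℂ)) := by
  rw [eischenLiu_tauj_iff]
  have e₁ : (|(n : ℝ) - ((-mPrime n : ℤ) : ℝ) / 2 + 5 / 2| : ℝ) = |2 * (n : ℝ) + 4| := by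
    congr 1
    simp only [mPrime, Int.cast_neg, Int.cast_add, Int.cast_mul, Int.cast_ofNat]
    ring
  have e₂ : (|(n : ℝ) - ((-mPrime n : ℤ) : ℝ) / 2 + 1 / 2| : ℝ) = |2 * (n : ℝ) + 2| := by
    congr 1
    simp only [mPrime, Int.cast_neg, Int.cast_add, Int.cast_mul, Int.cast_ofNat]
    ring
  simp only [e₁, e₂]

end TwistReadings

/-- Non-vanishing at `s = 1` of the display on the record's weights at τ′₁, for every twist
(`Lfac_one_ne_zero` specialised — the only property THEOREM N4.3 consumes). -/
theorem lfac_one_ne_zero_tau1 (n r : ℤ) (L : ℂ → ℂ)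
    (hEL : Hyp.EischenLiu2024_Sec2_2 2 0 (tauRec₁ n) nuRec₁ r L) : L 1 ≠ 0 :=
  Lfac_one_ne_zero hEL

/-- Non-vanishing at `s = 1` of the display on the record's weights at τ′_j, for every twist. -/
theorem lfac_one_ne_zero_tauj (n r : ℤ) (L : ℂ → ℂ)
    (hEL : Hyp.EischenLiu2024_Sec2_2 1 1 (tauRec n) (nuRec n) r L) : L 1 ≠ 0 :=
  Lfac_one_ne_zero hEL

end N43Weights

end Summit.Ventures.HodgeRepro2.T6
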